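import Literature.Geometry.Kaehler.ComplexTorusAnalyticLimitIrreducible
import HarnessLib

/-!
# The multiplicity function of the limit chain on the regular locus of the limit set

Layer `Literature/Geometry/Kaehler`; lane `lit-hodgefound`, seat p07, programme «BOUNDED CYCLES ON A
COMPLEX TORUS», file 8 (stepping stone for the descent of the limit chain to an effective cycle
`Σ m_ν W_ν` of `X` in the REDUCIBLE case). For `[π⁻¹ Z_j] → [T]`, `T ≥ 0`, `W = π(|T|)`:

* **`ComplexTorus.exists_multiplicity_limit`** — there is `m : X → ℤ` with (i) `θ_T = m ∘ π` on
  `reg|T| = π⁻¹(reg W)`, (ii) `m` CONTINUOUS (locally constant) on `reg W`, (iii) `m ≥ 1` on `reg W`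
  [Chirka1989, §16.1 Prop. 1 (proof), p. 207: *"integer valued and locally constant on `reg A`"*];
* `ComplexTorus.multiplicity_limit_eq_of_mem_connectedComponentIn` — hence `m` is constant on every
  connected component of `reg W` (*"constant on every connected component `S_ν`"*);
* **`ComplexTorus.mult_limit_eq_of_mem_connectedComponentIn`** — two components of `T` containing
  regular points of `|T|` over the same connected component of `reg W` have the same multiplicity
  (the multiplicity `m_ν` of the future component `A_ν = cl S_ν` of the limit cycle).

Theorems only; no new definitions, no named facts.

## References

* [Chirka1989] E. M. Chirka, *Complex Analytic Sets*, Kluwer 1989, §5.4 Thm. (p. 57), §16.1 Prop. 1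
  and its proof (pp. 206–207).
* [LangeBirkenhake1992] H. Lange, Ch. Birkenhake, *Complex Abelian Varieties*, Springer 1992,
  Lemma 1.1.3.
-/

noncomputable section

open scoped Manifold ENNReal NNReal Topology Distributions
open MeasureTheory TopologicalSpace Set Function Filter Metric Complex
open Literature.Geometry.GeometricMeasureTheory

namespace Literature.Geometry.Kaehler

-- Nested operator-norm instances on `Covector V m` / `Multivector V m`, as in `Currents.lean`.
set_option maxSynthPendingDepth 2

universe u

namespace ComplexTorus

variable {ι : Type*} [Fintype ι] {E : Type u} [NormedAddCommGroup E]
  [InnerProductSpace ℂ E] [FiniteDimensional ℂ E] [MeasurableSpace E] [BorelSpace E]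
  (Φ : (ι → ℝ) ≃L[ℝ] E) {d : ℕ}
  {Z : ℕ → Set (ComplexTorus Φ)} (hZ : ∀ j, HasPureDim 𝓘(ℂ, E) (Z j) (d + 1))
  {T : HolomorphicChain 𝓘(ℂ, E) (⊤ : Opens E) (d + 1)}

/-- **The multiplicity function of the limit chain on `reg W`.** There is `m : X → ℤ` with
`θ_T(x) = m(π x)` for `x ∈ reg|T| = π⁻¹(reg W)`, `m` continuous (i.e. locally constant) on `reg W`,
and `m ≥ 1` on `reg W`. [cite: Chirka1989, §16.1 Prop. 1 (proof), p. 207; LangeBirkenhake1992, Lemma 1.1.3] -/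
theorem exists_multiplicity_limit (hT : ∀ Y, 0 ≤ T.mult Y)
    (hconv : ∀ ψ, Tendsto (fun j ↦ (analyticChain Φ (hZ j)).toCurrent ψ) atTop (𝓝 (T.toCurrent ψ))) :
    ∃ m : ComplexTorus Φ → ℤ, (∀ x ∈ T.carrier, T.density x = m (cover Φ x)) ∧
      ContinuousOn m (regularLocus 𝓘(ℂ, E) (cover Φ '' (((↑) : (⊤ : Opens E) → E) '' T.support))) ∧
      ∀ z ∈ regularLocus 𝓘(ℂ, E) (cover Φ '' (((↑) : (⊤ : Opens E) → E) '' T.support)), 1 ≤ m z := by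
  set W := cover Φ '' (((↑) : (⊤ : Opens E) → E) '' T.support) with hW
  obtain ⟨m, hm⟩ := exists_density_limit_eq_comp_cover Φ hZ hT hconv
  -- regular points of `|T|` over points of the carrier
  have hreg : ∀ {x : E}, x ∈ T.carrier →
      (⟨x, trivial⟩ : (⊤ : Opens E)) ∈ regularLocus 𝓘(ℂ, E) T.support := by
    rintro x ⟨y, hy, hyx⟩
    have : y = ⟨x, trivial⟩ := Subtype.ext hyx
    rwa [this] at hy
  refine ⟨m, hm, fun z₀ hz₀ ↦ ?_, fun z hz ↦ ?_⟩
  · obtain ⟨x₀, rfl⟩ := cover_surjective Φ z₀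
    have hx₀ : x₀ ∈ T.carrier := (mem_carrier_limit_iff Φ hZ hconv x₀).2 hz₀
    -- local constancy upstairs, transported to `E` along `topHomeomorph.symm`
    have hev : ∀ᶠ x in 𝓝 x₀, x ∈ T.carrier → T.density x = T.density x₀ := by
      have h := (topHomeomorph (E := E)).symm.continuous.continuousAt.eventually
        (T.eventually_multAt_eq_of_mem_regularLocus (hreg hx₀))
      filter_upwards [h] with x hx hxc
      obtain ⟨yx, hyx, hyxx⟩ := hxc
      have hyx' : yx = topHomeomorph.symm x := Subtype.ext hyxx
      have h1 : T.density x = T.multAt (topHomeomorph.symm x) :=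
        T.density_apply_coe (topHomeomorph.symm x)
      have h2 : T.density x₀ = T.multAt ⟨x₀, trivial⟩ := T.density_apply_coe ⟨x₀, trivial⟩
      rw [h1, h2]
      exact hx (hyx' ▸ hyx).1
    obtain ⟨U, hUsub, hUo, hx₀U⟩ := _root_.eventually_nhds_iff.1 hev
    have hVo : IsOpen (cover Φ '' U) := (isOpenQuotientMap_cover (Φ := Φ)).isOpenMap U hUo
    have key : ∀ z ∈ cover Φ '' U ∩ regularLocus 𝓘(ℂ, E) W, m z = m (cover Φ x₀) := by
      rintro _ ⟨⟨x, hxU, rfl⟩, hz⟩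
      have hxc : x ∈ T.carrier := (mem_carrier_limit_iff Φ hZ hconv x).2 hz
      rw [← hm x hxc, ← hm x₀ hx₀]
      exact hUsub x hxU hxc
    refine (tendsto_pure.2 ?_).mono_right (pure_le_nhds _)
    filter_upwards [inter_mem_nhdsWithin _ (hVo.mem_nhds ⟨x₀, hx₀U, rfl⟩)] with z hz
    exact key z ⟨hz.2, hz.1⟩
  · obtain ⟨x, rfl⟩ := cover_surjective Φ z
    have hx : x ∈ T.carrier := (mem_carrier_limit_iff Φ hZ hconv x).2 hz
    rw [← hm x hx, T.density_apply_coe ⟨x, trivial⟩]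
    exact T.one_le_multAt_of_mem_support hT (hreg hx).1

omit [FiniteDimensional ℂ E] [MeasurableSpace E] [BorelSpace E] in
/-- **A multiplicity function as above is constant on the connected components of `reg W`.**
[cite: Chirka1989, §16.1 Prop. 1 (proof), p. 207] -/
theorem multiplicity_limit_eq_of_mem_connectedComponentIn {m : ComplexTorus Φ → ℤ}
    (hm : ContinuousOn m (regularLocus 𝓘(ℂ, E) (cover Φ '' (((↑) : (⊤ : Opens E) → E) '' T.support))))
    {z z' : ComplexTorus Φ}
    (hz : z ∈ regularLocus 𝓘(ℂ, E) (cover Φ '' (((↑) : (⊤ : Opens E) → E) '' T.support)))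
    (hz' : z' ∈ connectedComponentIn
      (regularLocus 𝓘(ℂ, E) (cover Φ '' (((↑) : (⊤ : Opens E) → E) '' T.support))) z) :
    m z' = m z :=
  (isPreconnected_connectedComponentIn.constant (hm.mono (connectedComponentIn_subset _ _))
    hz' (mem_connectedComponentIn hz))

/-- **Components of the limit chain over the same connected component of `reg W` have the same
multiplicity**: if `C ∋ y`, `C' ∋ y'` are components of `T` through regular points `y, y'` of `|T|`
with `π(y')` in the connected component of `π(y)` in `reg W`, then `k_C = k_{C'}`.
[cite: Chirka1989, §16.1 Prop. 1 (proof), p. 207; §5.4 Theorem (1), p. 57] -/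
theorem mult_limit_eq_of_mem_connectedComponentIn (hT : ∀ Y, 0 ≤ T.mult Y)
    (hconv : ∀ ψ, Tendsto (fun j ↦ (analyticChain Φ (hZ j)).toCurrent ψ) atTop (𝓝 (T.toCurrent ψ)))
    {C C' : Set (⊤ : Opens E)} (hC : T.mult C ≠ 0) (hC' : T.mult C' ≠ 0) {y y' : (⊤ : Opens E)}
    (hy : y ∈ regularLocus 𝓘(ℂ, E) T.support) (hyC : y ∈ C)
    (hy' : y' ∈ regularLocus 𝓘(ℂ, E) T.support) (hyC' : y' ∈ C')
    (hcc : cover Φ (y' : E) ∈ connectedComponentIn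
      (regularLocus 𝓘(ℂ, E) (cover Φ '' (((↑) : (⊤ : Opens E) → E) '' T.support))) (cover Φ (y : E))) :
    T.mult C = T.mult C' := by
  obtain ⟨m, hm, hmc, -⟩ := exists_multiplicity_limit Φ hZ hT hconv
  have hyc : (y : E) ∈ T.carrier := ⟨y, hy, rfl⟩
  have hyc' : (y' : E) ∈ T.carrier := ⟨y', hy', rfl⟩
  rw [← T.multAt_eq_mult_of_mem_regularLocus hC hy hyC, ← T.multAt_eq_mult_of_mem_regularLocus hC' hy' hyC',
    ← T.density_apply_coe y, ← T.density_apply_coe y', hm _ hyc, hm _ hyc']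
  exact (multiplicity_limit_eq_of_mem_connectedComponentIn Φ hmc
    ((mem_carrier_limit_iff Φ hZ hconv _).1 hyc) hcc).symm

/-- **The multiplicity at regular points of `|T|` over the same connected component of `reg W`
coincides.** [cite: Chirka1989, §16.1 Prop. 1 (proof), p. 207] -/
theorem multAt_limit_eq_of_mem_connectedComponentIn (hT : ∀ Y, 0 ≤ T.mult Y)
    (hconv : ∀ ψ, Tendsto (fun j ↦ (analyticChain Φ (hZ j)).toCurrent ψ) atTop (𝓝 (T.toCurrent ψ)))
    {y y' : (⊤ : Opens E)} (hy : y ∈ regularLocus 𝓘(ℂ, E) T.support)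
    (hy' : y' ∈ regularLocus 𝓘(ℂ, E) T.support)
    (hcc : cover Φ (y' : E) ∈ connectedComponentIn
      (regularLocus 𝓘(ℂ, E) (cover Φ '' (((↑) : (⊤ : Opens E) → E) '' T.support))) (cover Φ (y : E))) :
    T.multAt y = T.multAt y' := by
  obtain ⟨C, hC, hyC⟩ := HolomorphicChain.mem_support_iff.1 hy.1
  obtain ⟨C', hC', hyC'⟩ := HolomorphicChain.mem_support_iff.1 hy'.1
  rw [T.multAt_eq_mult_of_mem_regularLocus hC hy hyC, T.multAt_eq_mult_of_mem_regularLocus hC' hy' hyC']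
  exact mult_limit_eq_of_mem_connectedComponentIn Φ hZ hT hconv hC hC' hy hyC hy' hyC' hcc

end ComplexTorus

end Literature.Geometry.Kaehler

end
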